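import Literature.IUT.LogThetaLattice.PacketWeightsScaling

/-!
# [IUTchIII] Remark 3.1.1 (iv) / Proposition 3.9 (i): the `E`-weighted measure is invariant under RELABELLING
# of the data — permutations of the capsule index set on GENERAL regions (proof-only companion of
# `PacketWeights.lean`; abc-iut cell, sub-DAG row Prop-39.i.r7 of the [IUTchIII] Prop. 3.9 census)

S. Mochizuki, *Inter-universal Teichmüller theory III*, kurims manuscript (May 2020), §3: Remark 3.1.1 (iv) p. 97
(`μ_E(S)` "is completely determined by … `(V, N, M)`", the measure on `M_{E*V} ≅ M_W` of `S_E`) and Proposition 3.9 (i)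
p. 116 l. 20–22: "In both the nonarchimedean and archimedean cases, '`μ^log_{A,v_ℚ}`' is invariant with respect to
permutations of `A`" [claim: Mochizuki2012, status: disputed]. In the packet `𝓘^ℚ(^A𝓕_{v_ℚ})` the index set of summands is
`V = {collections {v_α}_{α∈A}}`, `N_v = #E_v = Π_α [K_{v_α} : (F_mod)_{v_α}]`, `M_v = ⊗_α K_{v_α}` (Rmk. 3.1.1 (iii) p. 96); a
permutation `σ` of `A` RELABELS this data: `v ↦ v ∘ σ`, with the evident bijections `E_{v∘σ} ≅ E_v` and measure-preserving
isomorphisms `M_{v∘σ} ≅ M_v` (permuting tensor factors). The statement file `PacketLogVolumes.lean` proves the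
permutation clause on DIRECT PRODUCT regions (`packetLogVolume_perm`) and the divisor-level models
(`capsuleLogVolume_perm`, abc-iut-L6-d3); print's `𝕄(−)` is ALL nonempty compact opens. THIS FILE proves, for the
`E`-weighted measure `weightedMeasure E M μ` of `PacketWeights.lean` (abc-iut-L6-t4) on ARBITRARY regions, that it is
invariant under every isomorphism of the data `(V, E, M, μ)`:

* **`weightedMeasure_comp_equiv`** — REINDEXING the summands along `π : V' ≃ V` (data pulled back literally:
  `E ∘ π`, `M ∘ π`, `μ ∘ π`): `μ_{E∘π}(Ψ⁻¹ S) = μ_E(S)` for `Ψ = MeasurableEquiv.piCongrLeft M π : M_{V'} ≃ M_V` — via the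
  induced equivalence `W' ≃ W` of the index sets `W = Σ_v E_{≠v}` (`Equiv.sigmaCongr` / `Equiv.piCongrLeft` on
  `E_{≠v} = Π_{u≠v} E_u`), the transport of `S_E` (`weightedMeasureSet_comp_equiv`) and Mathlib's
  `measurePreserving_piCongrLeft` for `Measure.pi`;
* **`weightedMeasure_congr_fibreEquiv`** — re-choosing the finite sets `E_v` along bijections `ε_v : E₁_v ≃ E₂_v` (same
  cardinalities `N_v`): `μ_{E₁}(S) = μ_{E₂}(S)` — the printed "completely determined by (V, N, M)";
* **`weightedMeasure_preimage_pi_of_map_eq`** — replacing the summands along measurable maps `φ_v : M₁_v → M₂_v` with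
  `(μ₁_v).map φ_v = μ₂_v`: `μ_E^{(1)}(Φ⁻¹ S) = μ_E^{(2)}(S)` (Mathlib `Measure.pi_map_pi`, as in
  `PacketWeightsScaling.lean`);
* **`weightedMeasure_relabel`** — all three at once: for `π : V' ≃ V`, `ε_{v'} : E'_{v'} ≃ E_{π v'}` and measure-preserving
  measurable equivalences `m_{v'} : M'_{v'} ≃ M_{π v'}`, `μ_{E'}(Φ⁻¹ S) = μ_E(S)` for the induced `Φ : M_{V'} → M_V` — the
  general-region form of the permutation clause of Prop. 3.9 (i) (take `V' = V`, `π = (· ∘ σ)`), hence of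
  `(1/N_E)·log μ_E` and of abc-iut-c312-6's verbatim `Summit.ABC.IUTFork.Cor312Vol.packetLogvolE`.

No definitions; Mathlib only (product measures, equivalences). Nothing here bears on the disputed [IUTchIII] Cor. 3.12
or takes a side; typed ≠ proved elsewhere.
-/

namespace Literature.IUT.LogThetaLattice

open MeasureTheory
open scoped ENNReal

universe u₁ u₁' u₂ u₃

/-! ## Replacing the summands along measure-compatible maps -/

section MapEq

variable {V : Type u₁} [Fintype V] [DecidableEq V] {E : V → Type u₂} [∀ v, Fintype (E v)]
variable {M₁ M₂ : V → Type u₃} [∀ v, MeasurableSpace (M₁ v)] [∀ v, MeasurableSpace (M₂ v)]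

omit [Fintype V] [DecidableEq V] [∀ v, Fintype (E v)] [∀ v, MeasurableSpace (M₁ v)]
  [∀ v, MeasurableSpace (M₂ v)] in
/-- `S_E` of a coordinatewise preimage along maps `φ_v : M₁_v → M₂_v` is the coordinatewise preimage of `S_E` on `M_W`
([IUTchIII] Rmk. 3.1.1 (iv) p. 97; definitional). [claim: Mochizuki2012, status: disputed]
(IUTchIII §3 Rmk 3.1.1 (iv), kurims p.97) -/
theorem weightedMeasureSet_preimage_pi' (φ : ∀ v, M₁ v → M₂ v) (S : Set (∀ v, M₂ v)) :
    weightedMeasureSet E M₁ ((fun x : (∀ v, M₁ v) => fun v => φ v (x v)) ⁻¹' S) =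
      (fun n : (∀ w : WIndex E, M₁ w.1) => fun w => φ w.1 (n w)) ⁻¹' weightedMeasureSet E M₂ S :=
  Set.ext fun _ => Iff.rfl

/-- **Replacing the summands** ([IUTchIII] Rmk. 3.1.1 (iv) p. 97 "completely determined by … `(V, N, M)`"): if measurable
maps `φ_v : M₁_v → M₂_v` carry `μ₁_v` to `μ₂_v` (`(μ₁_v).map φ_v = μ₂_v`; e.g. measure-preserving isomorphisms of the
summands), then `μ_E^{(1)}(Φ⁻¹ S) = μ_E^{(2)}(S)` for every measurable `S ⊆ M_V^{(2)}`, `Φ` coordinatewise. PROVED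
(Mathlib `Measure.pi_map_pi`). [claim: Mochizuki2012, status: disputed] (IUTchIII §3 Rmk 3.1.1 (iv), kurims p.97) -/
theorem weightedMeasure_preimage_pi_of_map_eq (μ₁ : ∀ v, Measure (M₁ v)) (μ₂ : ∀ v, Measure (M₂ v))
    [∀ v, SigmaFinite (μ₂ v)] (φ : ∀ v, M₁ v → M₂ v) (hφm : ∀ v, Measurable (φ v))
    (hφ : ∀ v, (μ₁ v).map (φ v) = μ₂ v) {S : Set (∀ v, M₂ v)} (hS : MeasurableSet S) :
    weightedMeasure E M₁ μ₁ ((fun x : (∀ v, M₁ v) => fun v => φ v (x v)) ⁻¹' S) = weightedMeasure E M₂ μ₂ S := by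
  unfold weightedMeasure
  rw [weightedMeasureSet_preimage_pi']
  have hΨ : Measurable (fun n : (∀ w : WIndex E, M₁ w.1) => fun w => φ w.1 (n w)) :=
    measurable_pi_lambda _ fun w => (hφm w.1).comp (measurable_pi_apply w)
  rw [← Measure.map_apply hΨ (measurableSet_weightedMeasureSet hS)]
  haveI : ∀ w : WIndex E, SigmaFinite (((fun w : WIndex E => μ₁ w.1) w).map (φ w.1)) := fun w => by
    show SigmaFinite ((μ₁ w.1).map (φ w.1))
    rw [hφ]
    infer_instance
  rw [Measure.pi_map_pi (μ := fun w : WIndex E => μ₁ w.1) (f := fun w : WIndex E => φ w.1)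
    (fun w => (hφm w.1).aemeasurable)]
  have hfam : (fun w : WIndex E => (μ₁ w.1).map (φ w.1)) = fun w : WIndex E => μ₂ w.1 :=
    funext fun w => hφ w.1
  rw [hfam]

end MapEq

/-! ## Re-choosing the finite sets `E_v` (same cardinalities) -/

section FibreEquiv

variable {V : Type u₁} [Fintype V] [DecidableEq V] {E₁ E₂ : V → Type u₂} [∀ v, Fintype (E₁ v)] [∀ v, Fintype (E₂ v)]
variable {M : V → Type u₃} [∀ v, MeasurableSpace (M v)]

omit [Fintype V] [DecidableEq V] [∀ v, Fintype (E₁ v)] [∀ v, Fintype (E₂ v)] [∀ v, MeasurableSpace (M v)] in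
/-- `W₁ ≃ W₂` carries `S_{E₂}` to `S_{E₁}`: `n ↦ (w₁ ↦ n(ω w₁))` maps into `S_{E₁}` exactly the elements of `S_{E₂}`
(definitional up to the bijection `e₁ ↦ ε ∘ e₁` of `E₁ = Π_v E₁_v` with `E₂`; [IUTchIII] Rmk. 3.1.1 (iv) p. 97).
[claim: Mochizuki2012, status: disputed] (IUTchIII §3 Rmk 3.1.1 (iv), kurims p.97) -/
theorem weightedMeasureSet_congr_fibreEquiv (ε : ∀ v, E₁ v ≃ E₂ v) (S : Set (∀ v, M v))
    (n : ∀ w : WIndex E₂, M w.1) :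
    (fun w₁ : WIndex E₁ => n ((Equiv.sigmaCongrRight fun v : V => Equiv.piCongrRight fun u : {u : V // u ≠ v} => ε u.1) w₁)) ∈
        weightedMeasureSet E₁ M S ↔
      n ∈ weightedMeasureSet E₂ M S := by
  constructor
  · intro h e₂
    -- glue along `ε⁻¹ ∘ e₂`; the glued point is the one of `e₂`
    have h' : (fun v => n ⟨v, restrictNe E₂ v fun v => ε v ((ε v).symm (e₂ v))⟩) ∈ S :=
      h fun v => (ε v).symm (e₂ v)
    have hre : (fun v => ε v ((ε v).symm (e₂ v))) = e₂ := funext fun v => (ε v).apply_symm_apply (e₂ v)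
    rw [hre] at h'
    exact h'
  · intro h e₁
    exact h fun v => ε v (e₁ v)

/-- **Re-choosing the sets `E_v`** ([IUTchIII] Rmk. 3.1.1 (iv) p. 97: `μ_E` "is completely determined by … `(V, N, M)`",
`N_v = #E_v`): along bijections `ε_v : E₁_v ≃ E₂_v` the `E`-weighted measures agree on EVERY region,
`μ_{E₁}(S) = μ_{E₂}(S)`. PROVED (transport of `Measure.pi` along `W₁ ≃ W₂`, Mathlib `measurePreserving_piCongrLeft`).
[claim: Mochizuki2012, status: disputed] (IUTchIII §3 Rmk 3.1.1 (iv), kurims p.97) -/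
theorem weightedMeasure_congr_fibreEquiv (ε : ∀ v, E₁ v ≃ E₂ v) (μ : ∀ v, Measure (M v)) [∀ v, SigmaFinite (μ v)]
    (S : Set (∀ v, M v)) :
    weightedMeasure E₁ M μ S = weightedMeasure E₂ M μ S := by
  have hΩ : MeasurePreserving (MeasurableEquiv.piCongrLeft (fun w₂ : WIndex E₂ => M w₂.1) ((Equiv.sigmaCongrRight fun v : V => Equiv.piCongrRight fun u : {u : V // u ≠ v} => ε u.1)))
      (Measure.pi fun w₁ : WIndex E₁ => μ ((Equiv.sigmaCongrRight fun v : V => Equiv.piCongrRight fun u : {u : V // u ≠ v} => ε u.1) w₁).1) (Measure.pi fun w₂ : WIndex E₂ => μ w₂.1) :=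
    measurePreserving_piCongrLeft (fun w₂ : WIndex E₂ => μ w₂.1) ((Equiv.sigmaCongrRight fun v : V => Equiv.piCongrRight fun u : {u : V // u ≠ v} => ε u.1))
  -- `S_{E₁} = Ω⁻¹(S_{E₂})`
  have hset : weightedMeasureSet E₁ M S =
      (MeasurableEquiv.piCongrLeft (fun w₂ : WIndex E₂ => M w₂.1) ((Equiv.sigmaCongrRight fun v : V => Equiv.piCongrRight fun u : {u : V // u ≠ v} => ε u.1))) ⁻¹'
        weightedMeasureSet E₂ M S := by
    ext n₁
    have hn : (fun w₁ : WIndex E₁ =>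
        (MeasurableEquiv.piCongrLeft (fun w₂ : WIndex E₂ => M w₂.1) ((Equiv.sigmaCongrRight fun v : V => Equiv.piCongrRight fun u : {u : V // u ≠ v} => ε u.1))) n₁ ((Equiv.sigmaCongrRight fun v : V => Equiv.piCongrRight fun u : {u : V // u ≠ v} => ε u.1) w₁)) = n₁ :=
      (MeasurableEquiv.piCongrLeft (fun w₂ : WIndex E₂ => M w₂.1) ((Equiv.sigmaCongrRight fun v : V => Equiv.piCongrRight fun u : {u : V // u ≠ v} => ε u.1))).symm_apply_apply n₁
    constructor
    · intro h
      show (MeasurableEquiv.piCongrLeft (fun w₂ : WIndex E₂ => M w₂.1) ((Equiv.sigmaCongrRight fun v : V => Equiv.piCongrRight fun u : {u : V // u ≠ v} => ε u.1))) n₁ ∈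
        weightedMeasureSet E₂ M S
      rw [← weightedMeasureSet_congr_fibreEquiv ε S, hn]
      exact h
    · intro h
      have h' := (weightedMeasureSet_congr_fibreEquiv ε S _).mpr h
      rw [hn] at h'
      exact h'
  unfold weightedMeasure
  rw [hset]
  exact hΩ.measure_preimage_equiv _

end FibreEquiv

/-! ## Reindexing the summands along `π : V' ≃ V` -/

section Reindex

variable {V : Type u₁} {V' : Type u₁'} [Fintype V] [DecidableEq V] [Fintype V'] [DecidableEq V']
  {E : V → Type u₂} [∀ v, Fintype (E v)] {M : V → Type u₃} [∀ v, MeasurableSpace (M v)]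

omit [Fintype V] [DecidableEq V] [Fintype V'] [DecidableEq V'] [∀ v, Fintype (E v)] in
/-- `S_{E∘π}` of the reindexed region `Ψ⁻¹ S` corresponds to `S_E` under the equivalence of the big products `M_{W'} ≃ M_W`
induced by `π` on the base and by ANY fibre transport `F_{v'} : (E∘π)_{≠v'} ≃ E_{≠ π v'}` compatible with restriction of
families ([IUTchIII] Rmk. 3.1.1 (iv) p. 97). [claim: Mochizuki2012, status: disputed]
(IUTchIII §3 Rmk 3.1.1 (iv), kurims p.97) -/
theorem weightedMeasureSet_comp_equiv_of_fibre (π : V' ≃ V)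
    (F : ∀ v' : V', ERest (fun v' => E (π v')) v' ≃ ERest E (π v'))
    (hF : ∀ (v' : V') (e : ∀ v, E v),
      F v' (restrictNe (fun v' => E (π v')) v' (fun v' => e (π v'))) = restrictNe E (π v') e)
    (S : Set (∀ v, M v)) (n : ∀ w : WIndex E, M w.1) :
    (fun w' : WIndex (fun v' => E (π v')) => n (Equiv.sigmaCongr π F w')) ∈
        weightedMeasureSet (fun v' => E (π v')) (fun v' => M (π v'))
          ((MeasurableEquiv.piCongrLeft M π) ⁻¹' S) ↔
      n ∈ weightedMeasureSet E M S := by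
  simp only [weightedMeasureSet, Set.mem_setOf_eq, Set.mem_preimage, unglue]
  -- the core identity: gluing `n ∘ ω` along `e ∘ π` and reindexing gives gluing `n` along `e`
  have core : ∀ e : ∀ v, E v,
      (MeasurableEquiv.piCongrLeft M π)
          (fun v' => n (Equiv.sigmaCongr π F ⟨v', restrictNe (fun v' => E (π v')) v' (fun v' => e (π v'))⟩)) =
        fun v => n ⟨v, restrictNe E v e⟩ := by
    intro e
    funext v
    obtain ⟨v', rfl⟩ := π.surjective v
    rw [MeasurableEquiv.piCongrLeft_apply_apply]
    show n ⟨π v', F v' (restrictNe (fun v' => E (π v')) v' (fun v' => e (π v')))⟩ = n ⟨π v', restrictNe E (π v') e⟩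
    rw [hF]
  constructor
  · intro h e
    rw [← core e]
    exact h fun v' => e (π v')
  · intro h e'
    -- `e' = e ∘ π` for `e := piCongrLeft E π e'`
    obtain ⟨e, rfl⟩ : ∃ e : ∀ v, E v, e' = fun v' => e (π v') :=
      ⟨Equiv.piCongrLeft E π e', funext fun v' => (Equiv.piCongrLeft_apply_apply E π e' v').symm⟩
    rw [core e]
    exact h e

/-- **Reindexing the summands** (abstract fibre transport): along `π : V' ≃ V` and fibre transports `F` compatible with
restriction of families, `μ_{E∘π}(Ψ⁻¹ S) = μ_E(S)` for EVERY `S ⊆ M_V` ([IUTchIII] Rmk. 3.1.1 (iv) p. 97 / Prop. 3.9 (i)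
p. 116 l. 20–22). PROVED (transport of `Measure.pi` along `W' ≃ W`, Mathlib `measurePreserving_piCongrLeft`).
[claim: Mochizuki2012, status: disputed] (IUTchIII §3 Prop 3.9 (i), kurims p.116) -/
theorem weightedMeasure_comp_equiv_of_fibre (π : V' ≃ V)
    (F : ∀ v' : V', ERest (fun v' => E (π v')) v' ≃ ERest E (π v'))
    (hF : ∀ (v' : V') (e : ∀ v, E v),
      F v' (restrictNe (fun v' => E (π v')) v' (fun v' => e (π v'))) = restrictNe E (π v') e)
    (μ : ∀ v, Measure (M v)) [∀ v, SigmaFinite (μ v)] (S : Set (∀ v, M v)) :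
    weightedMeasure (fun v' => E (π v')) (fun v' => M (π v')) (fun v' => μ (π v'))
        ((MeasurableEquiv.piCongrLeft M π) ⁻¹' S) =
      weightedMeasure E M μ S := by
  have hΩ : MeasurePreserving (MeasurableEquiv.piCongrLeft (fun w : WIndex E => M w.1) (Equiv.sigmaCongr π F))
      (Measure.pi fun w' : WIndex (fun v' => E (π v')) => μ (Equiv.sigmaCongr π F w').1)
      (Measure.pi fun w : WIndex E => μ w.1) :=
    measurePreserving_piCongrLeft (fun w : WIndex E => μ w.1) (Equiv.sigmaCongr π F)
  have hset : weightedMeasureSet (fun v' => E (π v')) (fun v' => M (π v'))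
      ((MeasurableEquiv.piCongrLeft M π) ⁻¹' S) =
        (MeasurableEquiv.piCongrLeft (fun w : WIndex E => M w.1) (Equiv.sigmaCongr π F)) ⁻¹'
          weightedMeasureSet E M S := by
    ext n'
    have hn : (fun w' : WIndex (fun v' => E (π v')) =>
        (MeasurableEquiv.piCongrLeft (fun w : WIndex E => M w.1) (Equiv.sigmaCongr π F)) n'
          (Equiv.sigmaCongr π F w')) = n' :=
      (MeasurableEquiv.piCongrLeft (fun w : WIndex E => M w.1) (Equiv.sigmaCongr π F)).symm_apply_apply n'
    constructor
    · intro h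
      show (MeasurableEquiv.piCongrLeft (fun w : WIndex E => M w.1) (Equiv.sigmaCongr π F)) n' ∈
        weightedMeasureSet E M S
      rw [← weightedMeasureSet_comp_equiv_of_fibre π F hF S, hn]
      exact h
    · intro h
      have h' := (weightedMeasureSet_comp_equiv_of_fibre π F hF S _).mpr h
      rw [hn] at h'
      exact h'
  unfold weightedMeasure
  rw [hset]
  exact hΩ.measure_preimage_equiv _

omit [Fintype V] [DecidableEq V] [Fintype V'] [DecidableEq V'] [∀ v, Fintype (E v)] in
/-- The CANONICAL fibre transport along `π` — `(E∘π)_{≠v'} = Π_{u'≠v'} E_{π u'} ≃ Π_{u ≠ π v'} E_u = E_{≠ π v'}`, reindexing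
along `π : {u' ≠ v'} ≃ {u ≠ π v'}` — is compatible with restriction of families. [folklore] -/
private theorem piCongrLeft_restrictNe (π : V' ≃ V) (v' : V') (e : ∀ v, E v) :
    Equiv.piCongrLeft (fun u : {u : V // u ≠ π v'} => E u.1)
        (⟨fun u' => ⟨π u'.1, fun h => u'.2 (π.injective h)⟩,
          fun u => ⟨π.symm u.1, fun h => u.2 ((π.apply_symm_apply u.1).symm.trans (congrArg π h))⟩,
          fun u' => Subtype.ext (π.symm_apply_apply u'.1), fun u => Subtype.ext (π.apply_symm_apply u.1)⟩ :
          {u' : V' // u' ≠ v'} ≃ {u : V // u ≠ π v'})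
        (restrictNe (fun v' => E (π v')) v' (fun v' => e (π v'))) =
      restrictNe E (π v') e := by
  funext u
  obtain ⟨u', rfl⟩ :=
    ((⟨fun u' => ⟨π u'.1, fun h => u'.2 (π.injective h)⟩,
          fun u => ⟨π.symm u.1, fun h => u.2 ((π.apply_symm_apply u.1).symm.trans (congrArg π h))⟩,
          fun u' => Subtype.ext (π.symm_apply_apply u'.1), fun u => Subtype.ext (π.apply_symm_apply u.1)⟩ :
          {u' : V' // u' ≠ v'} ≃ {u : V // u ≠ π v'})).surjective u
  exact Equiv.piCongrLeft_apply_apply _ _ _ u'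

/-- **Reindexing the summands** ([IUTchIII] Rmk. 3.1.1 (iv) p. 97 / Prop. 3.9 (i) p. 116 l. 20–22 «invariant with
respect to permutations of `A`», general regions): along a bijection `π : V' ≃ V` of the index set of summands, with
the data pulled back literally (`E ∘ π`, `M ∘ π`, `μ ∘ π`), the `E`-weighted measure of the reindexed region equals the
original one: `μ_{E∘π}(Ψ⁻¹ S) = μ_E(S)`, `Ψ = MeasurableEquiv.piCongrLeft M π : M_{V'} ≃ M_V`, for EVERY `S ⊆ M_V`
(canonical fibre transport). PROVED. [claim: Mochizuki2012, status: disputed] (IUTchIII §3 Prop 3.9 (i), kurims p.116) -/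
theorem weightedMeasure_comp_equiv (π : V' ≃ V) (μ : ∀ v, Measure (M v)) [∀ v, SigmaFinite (μ v)]
    (S : Set (∀ v, M v)) :
    weightedMeasure (fun v' => E (π v')) (fun v' => M (π v')) (fun v' => μ (π v'))
        ((MeasurableEquiv.piCongrLeft M π) ⁻¹' S) =
      weightedMeasure E M μ S :=
  weightedMeasure_comp_equiv_of_fibre π
    (fun v' => Equiv.piCongrLeft (fun u : {u : V // u ≠ π v'} => E u.1)
      (⟨fun u' => ⟨π u'.1, fun h => u'.2 (π.injective h)⟩,
          fun u => ⟨π.symm u.1, fun h => u.2 ((π.apply_symm_apply u.1).symm.trans (congrArg π h))⟩,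
          fun u' => Subtype.ext (π.symm_apply_apply u'.1), fun u => Subtype.ext (π.apply_symm_apply u.1)⟩ :
          {u' : V' // u' ≠ v'} ≃ {u : V // u ≠ π v'}))
    (piCongrLeft_restrictNe π) μ S

end Reindex

/-! ## All at once: isomorphic data -/

section Relabel

variable {V : Type u₁} {V' : Type u₁'} [Fintype V] [DecidableEq V] [Fintype V'] [DecidableEq V']
  {E : V → Type u₂} [∀ v, Fintype (E v)] {M : V → Type u₃} [∀ v, MeasurableSpace (M v)]
  {E' : V' → Type u₂} [∀ v', Fintype (E' v')] {M' : V' → Type u₃} [∀ v', MeasurableSpace (M' v')]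

/-- **`μ_E` depends only on the isomorphism class of `(V, E, M, μ)`** ([IUTchIII] Rmk. 3.1.1 (iv) p. 97; Prop. 3.9 (i)
p. 116 l. 20–22 «invariant with respect to permutations of `A`» on GENERAL regions): given a bijection `π : V' ≃ V`,
bijections `ε_{v'} : E'_{v'} ≃ E_{π v'}` and measurable equivalences `m_{v'} : M'_{v'} ≃ M_{π v'}` preserving the measures
(`(μ'_{v'}).map m_{v'} = μ_{π v'}`), the `E'`-weighted measure of the preimage of any measurable `S ⊆ M_V` under the
induced map `M_{V'} → M_V`, `x ↦ Ψ(v' ↦ m_{v'}(x_{v'}))`, equals `μ_E(S)`. For a permutation `σ` of the capsule index set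
`A`: `V' = V = {collections {v_α}}`, `π = (· ∘ σ)`, `ε`, `m` = reindexing of `Π_α` / `⊗_α`. PROVED.
[claim: Mochizuki2012, status: disputed] (IUTchIII §3 Prop 3.9 (i), kurims p.116) -/
theorem weightedMeasure_relabel (π : V' ≃ V) (ε : ∀ v', E' v' ≃ E (π v')) (m : ∀ v', M' v' ≃ᵐ M (π v'))
    (μ : ∀ v, Measure (M v)) [∀ v, SigmaFinite (μ v)] (μ' : ∀ v', Measure (M' v'))
    (hm : ∀ v', (μ' v').map (m v') = μ (π v')) {S : Set (∀ v, M v)} (hS : MeasurableSet S) :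
    weightedMeasure E' M' μ'
        ((fun x : (∀ v', M' v') => fun v' => m v' (x v')) ⁻¹' ((MeasurableEquiv.piCongrLeft M π) ⁻¹' S)) =
      weightedMeasure E M μ S := by
  rw [weightedMeasure_preimage_pi_of_map_eq (E := E') μ' (fun v' => μ (π v')) (fun v' => ⇑(m v'))
    (fun v' => (m v').measurable) hm ((MeasurableEquiv.piCongrLeft M π).measurable hS)]
  rw [weightedMeasure_congr_fibreEquiv ε]
  exact weightedMeasure_comp_equiv π μ S

end Relabel

end Literature.IUT.LogThetaLattice
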